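import Summits.BirchSwinnertonDyer.BirchSwinnertonDyer.Theorems.ResidualThetaTransportAtTwoThetaLayerLambdaCongruenceAtTwoCuspSpanFourShift
import HarnessLib

/-!
# Route `ResidualThetaTransportAtTwo`, cruxes Kan⁺ (stmt-BirchSwinnertonDyer-20688) / Kμ⁺ / 21437: the 2-ARITHMETIC side of the node —
# an additive `𝔽₂`-character of `Γ₀(N)` that extends to the dyadic group `Λ(N) = Γ₀(N)[1/2]` kills every `4^k`-class and is
# four-shift invariant (the converse inclusions of the FOUR-SHIFT memo `Lines/birth-fourshift.md` §4 (a)(b), kernel form)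

Cell `bsd-wall`, width seat `bsd-wall-rtt-p3-w3` g6 (helper; THEOREMS ONLY — no `def`, no named fact, no `sorry`; `--supports
stmt-BirchSwinnertonDyer-20688`; BSD is not proved by this). Sequel of `…CuspSpanFourShift` (p623430).

`Λ(N) := {g ∈ SL₂(ℚ) : all entries in ℤ[1/2], lower-left entry in N·ℤ[1/2]}` is written INLINE as an arbitrary predicate `D` on
`SL(2, ℚ)` characterised by the hypothesis `hD` (no definition is introduced). For `χ̃ : SL(2, ℚ) → ZMod 2` additive on `D` and its
restriction `χ = χ̃ ∘ (↑)` to `Γ₀(N)`: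

* §1 `Λ(N)` is closed under products and contains `Γ₀(N)`, the unipotents `U⁺(x)` (`x` dyadic), `U⁻(y)` (`y ∈ N·ℤ[1/2]`) and the
  diagonal `2`-powers;
* §2 `χ̃` kills `1`, the unipotents (`U(x) = U(x/2)²`, characteristic `2`) and `diag(4^{-k}, 4^k) = diag(2^{-k}, 2^k)²`;
* §3 `chi_eq_zero_of_dyadic_of_natAbs_eq_four_pow` — **`χ` kills every `γ ∈ Γ₀(N)` with `|d(γ)| = 4^k`** (Bruhat factorisation
  `γ = U⁺(b/4^k) · diag(4^{-k}, 4^k) · U⁻(c/4^k)` in `Λ(N)`; the sign via `χ(−1) = 0`): the hypothesis V of the node is AUTOMATIC for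
  restrictions of characters of `Λ(N)` — and odd `2`-powers carry `χ̃(diag(2, ½))`, which is why V only sees even powers;
* §4 `chi_fourShift_of_dyadic` — **`χ(a, 4b; c, d) = χ(a, b; 4c, d)`** (conjugation by `diag(2, ½) ∈ Λ(N)`); with the small-trace
  hypothesis, the first-column form (Inv4) used by `heckeKernelSpan_of_fourShift` follows (`chi_fourShift_col_of_dyadic`).

So `res Hom(Λ(N), 𝔽₂) ⊆ {V-killed} ∩ {(Inv4)}`. The node (♠)_N asks for `{V-killed} ⊆ {(Inv4)}` (= extendable, by the amalgam
`Λ(N) = Γ₀(N) *_{Γ₀(2N)} Γ₀(N)^{diag(2,1)}`, Serre *Trees* II.1.4 — not formalised); `Hom(Λ(N), 𝔽₂) = Hom((ℤ/N)ˣ, 𝔽₂) ∘ d̄` is the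
congruence subgroup property of `SL₂(ℤ[1/2])` (Mennicke 1967, Serre 1970 — not used). References: J.-P. Serre, *Trees* (1980) II.1.4;
J. Mennicke, Invent. Math. 4 (1967); J.-P. Serre, Ann. of Math. 92 (1970); R. Pollack, Duke Math. J. 118 (2003) Conj. 6.3 [Pollack2003].
-/

set_option autoImplicit false
-- justification: the `Summit.BirchSwinnertonDyer.BirchSwinnertonDyer.…` path repeats a component (route-file convention)
set_option linter.dupNamespace false

noncomputable section

open scoped MatrixGroups

open CongruenceSubgroup Literature.NumberTheory.EllipticCurves.ModularForms Literature.NumberTheory.ModularForms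

namespace Summit.BirchSwinnertonDyer.BirchSwinnertonDyer.Theorems.SignedMuAtTwo

section Dyadic

variable {N : ℕ} {D : SL(2, ℚ) → Prop}

/-! ## §0. Entry bookkeeping in `SL(2, ℚ)` -/

/-- Entries of the image of `γ ∈ SL(2, ℤ)` in `SL(2, ℚ)`. [folklore] -/
theorem coe_rat_apply (γ : SL(2, ℤ)) (i j : Fin 2) : (γ : SL(2, ℚ)) i j = ((γ i j : ℤ) : ℚ) := by
  rw [Matrix.SpecialLinearGroup.coe_matrix_coe, Matrix.map_apply]; rfl

/-- A rational matrix `(p q; r s)` with `ps − qr = 1` is an element of `SL(2, ℚ)` with these entries. [folklore] -/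
theorem exists_sl2Rat_entries (p q r s : ℚ) (h : p * s - q * r = 1) :
    ∃ g : SL(2, ℚ), g 0 0 = p ∧ g 0 1 = q ∧ g 1 0 = r ∧ g 1 1 = s :=
  ⟨⟨!![p, q; r, s], by rw [Matrix.det_fin_two_of]; linear_combination h⟩, rfl, rfl, rfl, rfl⟩

/-- Entries of a product in `SL(2, ℚ)`. [folklore] -/
theorem sl2Rat_mul_apply (g h : SL(2, ℚ)) (i j : Fin 2) : (g * h) i j = g i 0 * h 0 j + g i 1 * h 1 j := by
  change ((g : Matrix (Fin 2) (Fin 2) ℚ) * (h : Matrix (Fin 2) (Fin 2) ℚ)) i j = _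
  rw [Matrix.mul_apply, Fin.sum_univ_two]

/-- Equality in `SL(2, ℚ)` from the four entries. [folklore] -/
theorem sl2Rat_ext {g h : SL(2, ℚ)} (h00 : g 0 0 = h 0 0) (h01 : g 0 1 = h 0 1) (h10 : g 1 0 = h 1 0)
    (h11 : g 1 1 = h 1 1) : g = h := by
  apply Matrix.SpecialLinearGroup.ext
  intro i j
  fin_cases i <;> fin_cases j
  · exact h00
  · exact h01
  · exact h10
  · exact h11

/-! ## §1. The dyadic level-`N` group `Λ(N)` (as an inline predicate) -/

/-- Sums of dyadic rationals are dyadic. [folklore] -/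
theorem dyadic_add {x y : ℚ} (hx : ∃ n : ℕ, ∃ m : ℤ, x = m / 2 ^ n) (hy : ∃ n : ℕ, ∃ m : ℤ, y = m / 2 ^ n) :
    ∃ n : ℕ, ∃ m : ℤ, x + y = m / 2 ^ n := by
  obtain ⟨n, m, rfl⟩ := hx
  obtain ⟨n', m', rfl⟩ := hy
  refine ⟨n + n', m * 2 ^ n' + m' * 2 ^ n, ?_⟩
  push_cast
  field_simp
  ring

/-- Products of dyadic rationals are dyadic. [folklore] -/
theorem dyadic_mul {x y : ℚ} (hx : ∃ n : ℕ, ∃ m : ℤ, x = m / 2 ^ n) (hy : ∃ n : ℕ, ∃ m : ℤ, y = m / 2 ^ n) :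
    ∃ n : ℕ, ∃ m : ℤ, x * y = m / 2 ^ n := by
  obtain ⟨n, m, rfl⟩ := hx
  obtain ⟨n', m', rfl⟩ := hy
  refine ⟨n + n', m * m', ?_⟩
  push_cast
  field_simp
  ring

/-- `N`-dyadic times dyadic is `N`-dyadic. [folklore] -/
theorem ndyadic_mul {x y : ℚ} (hx : ∃ n : ℕ, ∃ m : ℤ, x = N * m / 2 ^ n) (hy : ∃ n : ℕ, ∃ m : ℤ, y = m / 2 ^ n) :
    ∃ n : ℕ, ∃ m : ℤ, x * y = N * m / 2 ^ n := by
  obtain ⟨n, m, rfl⟩ := hx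
  obtain ⟨n', m', rfl⟩ := hy
  refine ⟨n + n', m * m', ?_⟩
  push_cast
  field_simp
  ring

/-- Dyadic times `N`-dyadic is `N`-dyadic. [folklore] -/
theorem mul_ndyadic {x y : ℚ} (hx : ∃ n : ℕ, ∃ m : ℤ, x = m / 2 ^ n) (hy : ∃ n : ℕ, ∃ m : ℤ, y = N * m / 2 ^ n) :
    ∃ n : ℕ, ∃ m : ℤ, x * y = N * m / 2 ^ n := by
  rw [mul_comm]; exact ndyadic_mul hy hx

/-- `N`-dyadic numbers are closed under addition. [folklore] -/
theorem ndyadic_add {x y : ℚ} (hx : ∃ n : ℕ, ∃ m : ℤ, x = N * m / 2 ^ n) (hy : ∃ n : ℕ, ∃ m : ℤ, y = N * m / 2 ^ n) :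
    ∃ n : ℕ, ∃ m : ℤ, x + y = N * m / 2 ^ n := by
  obtain ⟨n, m, rfl⟩ := hx
  obtain ⟨n', m', rfl⟩ := hy
  refine ⟨n + n', m * 2 ^ n' + m' * 2 ^ n, ?_⟩
  push_cast
  field_simp
  ring

/-- `N`-dyadic numbers are dyadic. [folklore] -/
theorem dyadic_of_ndyadic {x : ℚ} (hx : ∃ n : ℕ, ∃ m : ℤ, x = N * m / 2 ^ n) : ∃ n : ℕ, ∃ m : ℤ, x = m / 2 ^ n := by
  obtain ⟨n, m, rfl⟩ := hx
  exact ⟨n, N * m, by push_cast; ring⟩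

/-- **`Λ(N)` is closed under products.** [folklore] -/
theorem dyadic_pred_mul
    (hD : ∀ g : SL(2, ℚ), D g ↔ (∀ i j, ∃ n : ℕ, ∃ m : ℤ, g i j = m / 2 ^ n) ∧ ∃ n : ℕ, ∃ m : ℤ, g 1 0 = N * m / 2 ^ n)
    {g h : SL(2, ℚ)} (hg : D g) (hh : D h) : D (g * h) := by
  rw [hD] at hg hh ⊢
  refine ⟨fun i j ↦ ?_, ?_⟩
  · rw [sl2Rat_mul_apply]
    exact dyadic_add (dyadic_mul (hg.1 i 0) (hh.1 0 j)) (dyadic_mul (hg.1 i 1) (hh.1 1 j))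
  · rw [sl2Rat_mul_apply]
    exact ndyadic_add (ndyadic_mul hg.2 (hh.1 0 0)) (mul_ndyadic (hg.1 1 1) hh.2)

/-- **`Γ₀(N) ⊆ Λ(N)`.** [folklore] -/
theorem dyadic_pred_coe
    (hD : ∀ g : SL(2, ℚ), D g ↔ (∀ i j, ∃ n : ℕ, ∃ m : ℤ, g i j = m / 2 ^ n) ∧ ∃ n : ℕ, ∃ m : ℤ, g 1 0 = N * m / 2 ^ n)
    {γ : SL(2, ℤ)} (hγ : γ ∈ Gamma0 N) : D (γ : SL(2, ℚ)) := by
  rw [hD]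
  refine ⟨fun i j ↦ ⟨0, γ i j, by rw [coe_rat_apply]; simp⟩, ?_⟩
  obtain ⟨m, hm⟩ := dvd_entry_of_mem_Gamma0 N hγ
  exact ⟨0, m, by rw [coe_rat_apply, hm]; push_cast; simp⟩

/-- An element of `SL(2, ℚ)` with dyadic entries and lower-left entry in `N·ℤ[1/2]` lies in `Λ(N)` (entrywise form). [folklore] -/
theorem dyadic_pred_of_entries
    (hD : ∀ g : SL(2, ℚ), D g ↔ (∀ i j, ∃ n : ℕ, ∃ m : ℤ, g i j = m / 2 ^ n) ∧ ∃ n : ℕ, ∃ m : ℤ, g 1 0 = N * m / 2 ^ n)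
    {g : SL(2, ℚ)} (h00 : ∃ n : ℕ, ∃ m : ℤ, g 0 0 = m / 2 ^ n) (h01 : ∃ n : ℕ, ∃ m : ℤ, g 0 1 = m / 2 ^ n)
    (h10 : ∃ n : ℕ, ∃ m : ℤ, g 1 0 = N * m / 2 ^ n) (h11 : ∃ n : ℕ, ∃ m : ℤ, g 1 1 = m / 2 ^ n) : D g := by
  rw [hD]
  refine ⟨fun i j ↦ ?_, h10⟩
  fin_cases i <;> fin_cases j
  · exact h00
  · exact h01
  · exact dyadic_of_ndyadic h10
  · exact h11

/-! ## §2. An additive `𝔽₂`-character of `Λ(N)` kills `1`, the unipotents and the even diagonal `2`-powers -/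

variable {χt : SL(2, ℚ) → ZMod 2}

/-- `χ̃(1) = 0`. [folklore] -/
theorem chit_one
    (hD : ∀ g : SL(2, ℚ), D g ↔ (∀ i j, ∃ n : ℕ, ∃ m : ℤ, g i j = m / 2 ^ n) ∧ ∃ n : ℕ, ∃ m : ℤ, g 1 0 = N * m / 2 ^ n)
    (hadd : ∀ g h, D g → D h → χt (g * h) = χt g + χt h) : χt 1 = 0 := by
  have h1 : D 1 := by simpa using dyadic_pred_coe hD (Gamma0 N).one_mem
  have h := hadd 1 1 h1 h1
  rw [mul_one] at h
  rw [h]; exact CharTwo.add_self_eq_zero _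

/-- **Upper unipotents are killed**: `χ̃(U⁺(x)) = 0` for dyadic `x` — `U⁺(x) = U⁺(x/2)²` and `2 = 0`. [folklore] -/
theorem chit_upper
    (hD : ∀ g : SL(2, ℚ), D g ↔ (∀ i j, ∃ n : ℕ, ∃ m : ℤ, g i j = m / 2 ^ n) ∧ ∃ n : ℕ, ∃ m : ℤ, g 1 0 = N * m / 2 ^ n)
    (hadd : ∀ g h, D g → D h → χt (g * h) = χt g + χt h)
    {u : SL(2, ℚ)} (h00 : u 0 0 = 1) (h10 : u 1 0 = 0) (h11 : u 1 1 = 1) (hx : ∃ n : ℕ, ∃ m : ℤ, u 0 1 = m / 2 ^ n) :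
    χt u = 0 := by
  obtain ⟨v, v00, v01, v10, v11⟩ := exists_sl2Rat_entries 1 (u 0 1 / 2) 0 1 (by ring)
  have hv : D v := by
    refine dyadic_pred_of_entries hD ⟨0, 1, by rw [v00]; simp⟩ ?_ ⟨0, 0, by rw [v10]; simp⟩ ⟨0, 1, by rw [v11]; simp⟩
    obtain ⟨n, m, e⟩ := hx
    exact ⟨n + 1, m, by rw [v01, e, pow_succ]; ring⟩
  have huv : u = v * v := sl2Rat_ext (by rw [sl2Rat_mul_apply, v00, v01, v10, h00]; ring)
    (by rw [sl2Rat_mul_apply, v00, v01, v11]; ring) (by rw [sl2Rat_mul_apply, v10, v00, v11, h10]; ring)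
    (by rw [sl2Rat_mul_apply, v10, v01, v11, h11]; ring)
  rw [huv, hadd v v hv hv]; exact CharTwo.add_self_eq_zero _

/-- **Lower unipotents are killed**: `χ̃(U⁻(y)) = 0` for `y ∈ N·ℤ[1/2]`. [folklore] -/
theorem chit_lower
    (hD : ∀ g : SL(2, ℚ), D g ↔ (∀ i j, ∃ n : ℕ, ∃ m : ℤ, g i j = m / 2 ^ n) ∧ ∃ n : ℕ, ∃ m : ℤ, g 1 0 = N * m / 2 ^ n)
    (hadd : ∀ g h, D g → D h → χt (g * h) = χt g + χt h)
    {u : SL(2, ℚ)} (h00 : u 0 0 = 1) (h01 : u 0 1 = 0) (h11 : u 1 1 = 1) (hy : ∃ n : ℕ, ∃ m : ℤ, u 1 0 = N * m / 2 ^ n) :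
    χt u = 0 := by
  obtain ⟨v, v00, v01, v10, v11⟩ := exists_sl2Rat_entries 1 0 (u 1 0 / 2) 1 (by ring)
  have hv : D v := by
    refine dyadic_pred_of_entries hD ⟨0, 1, by rw [v00]; simp⟩ ⟨0, 0, by rw [v01]; simp⟩ ?_ ⟨0, 1, by rw [v11]; simp⟩
    obtain ⟨n, m, e⟩ := hy
    exact ⟨n + 1, m, by rw [v10, e, pow_succ]; ring⟩
  have huv : u = v * v := sl2Rat_ext (by rw [sl2Rat_mul_apply, v00, v01, v10, h00]; ring)
    (by rw [sl2Rat_mul_apply, v00, v01, v11, h01]; ring) (by rw [sl2Rat_mul_apply, v10, v00, v11]; ring)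
    (by rw [sl2Rat_mul_apply, v10, v01, v11, h11]; ring)
  rw [huv, hadd v v hv hv]; exact CharTwo.add_self_eq_zero _

/-- **Even diagonal `2`-powers are killed**: `χ̃(diag(4^{-k}, 4^k)) = 0` — it is `diag(2^{-k}, 2^k)²`. [folklore] -/
theorem chit_diag_four_pow
    (hD : ∀ g : SL(2, ℚ), D g ↔ (∀ i j, ∃ n : ℕ, ∃ m : ℤ, g i j = m / 2 ^ n) ∧ ∃ n : ℕ, ∃ m : ℤ, g 1 0 = N * m / 2 ^ n)
    (hadd : ∀ g h, D g → D h → χt (g * h) = χt g + χt h) (k : ℕ)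
    {t : SL(2, ℚ)} (h00 : t 0 0 = ((4 : ℚ) ^ k)⁻¹) (h01 : t 0 1 = 0) (h10 : t 1 0 = 0) (h11 : t 1 1 = (4 : ℚ) ^ k) :
    χt t = 0 := by
  obtain ⟨v, v00, v01, v10, v11⟩ := exists_sl2Rat_entries ((2 : ℚ) ^ k)⁻¹ 0 0 ((2 : ℚ) ^ k) (by simp)
  have hv : D v :=
    dyadic_pred_of_entries hD ⟨k, 1, by rw [v00]; simp⟩ ⟨0, 0, by rw [v01]; simp⟩ ⟨0, 0, by rw [v10]; simp⟩
      ⟨0, 2 ^ k, by rw [v11]; simp⟩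
  have h4 : (4 : ℚ) ^ k = 2 ^ k * 2 ^ k := by rw [← mul_pow]; norm_num
  have htv : t = v * v := sl2Rat_ext (by rw [sl2Rat_mul_apply, v00, v01, v10, h00, h4, mul_inv]; ring)
    (by rw [sl2Rat_mul_apply, v00, v01, v11, h01]; ring) (by rw [sl2Rat_mul_apply, v10, v00, v11, h10]; ring)
    (by rw [sl2Rat_mul_apply, v10, v01, v11, h11, h4]; ring)
  rw [htv, hadd v v hv hv]; exact CharTwo.add_self_eq_zero _

/-! ## §3. Restrictions of characters of `Λ(N)` kill the `4^k`-classes -/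

/-- **V is automatic for characters of `Λ(N)` (positive sign)**: `χ̃(γ) = 0` for every `γ ∈ Γ₀(N)` with `d(γ) = 4^k`, by the
Bruhat factorisation `γ = U⁺(b/4^k) · diag(4^{-k}, 4^k) · U⁻(c/4^k)` in `Λ(N)` (`a = (1 + bc)/d`). [folklore] -/
theorem chi_eq_zero_of_dyadic_of_apply_one_one_eq_four_pow
    (hD : ∀ g : SL(2, ℚ), D g ↔ (∀ i j, ∃ n : ℕ, ∃ m : ℤ, g i j = m / 2 ^ n) ∧ ∃ n : ℕ, ∃ m : ℤ, g 1 0 = N * m / 2 ^ n)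
    (hadd : ∀ g h, D g → D h → χt (g * h) = χt g + χt h)
    {γ : SL(2, ℤ)} (hγ : γ ∈ Gamma0 N) (k : ℕ) (hd : γ 1 1 = 4 ^ k) : χt (γ : SL(2, ℚ)) = 0 := by
  have h4 : (4 : ℚ) ^ k ≠ 0 := pow_ne_zero _ (by norm_num)
  have hdet : ((γ 0 0 : ℤ) : ℚ) * 4 ^ k - ((γ 0 1 : ℤ) : ℚ) * ((γ 1 0 : ℤ) : ℚ) = 1 := by
    have := Matrix.SpecialLinearGroup.det_coe γ
    rw [Matrix.det_fin_two, hd] at this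
    exact_mod_cast this
  -- the three factors
  obtain ⟨u, u00, u01, u10, u11⟩ := exists_sl2Rat_entries 1 (((γ 0 1 : ℤ) : ℚ) / 4 ^ k) 0 1 (by ring)
  obtain ⟨t, t00, t01, t10, t11⟩ := exists_sl2Rat_entries ((4 : ℚ) ^ k)⁻¹ 0 0 ((4 : ℚ) ^ k) (by simp)
  obtain ⟨l, l00, l01, l10, l11⟩ := exists_sl2Rat_entries 1 0 (((γ 1 0 : ℤ) : ℚ) / 4 ^ k) 1 (by ring)
  have hb : ∃ n : ℕ, ∃ m : ℤ, u 0 1 = m / 2 ^ n := ⟨2 * k, γ 0 1, by rw [u01, pow_mul]; norm_num⟩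
  have hc : ∃ n : ℕ, ∃ m : ℤ, l 1 0 = N * m / 2 ^ n := by
    obtain ⟨m, hm⟩ := dvd_entry_of_mem_Gamma0 N hγ
    exact ⟨2 * k, m, by rw [l10, hm, pow_mul]; push_cast; norm_num⟩
  have hDu : D u := dyadic_pred_of_entries hD ⟨0, 1, by rw [u00]; simp⟩ hb ⟨0, 0, by rw [u10]; simp⟩ ⟨0, 1, by rw [u11]; simp⟩
  have hDt : D t :=
    dyadic_pred_of_entries hD ⟨2 * k, 1, by rw [t00, pow_mul]; norm_num⟩ ⟨0, 0, by rw [t01]; simp⟩ ⟨0, 0, by rw [t10]; simp⟩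
      ⟨0, 4 ^ k, by rw [t11]; simp⟩
  have hDl : D l := dyadic_pred_of_entries hD ⟨0, 1, by rw [l00]; simp⟩ ⟨0, 0, by rw [l01]; simp⟩ hc ⟨0, 1, by rw [l11]; simp⟩
  -- `γ = u (t l)`
  have htl00 : (t * l) 0 0 = ((4 : ℚ) ^ k)⁻¹ := by rw [sl2Rat_mul_apply, t00, t01, l00, l10]; ring
  have htl01 : (t * l) 0 1 = 0 := by rw [sl2Rat_mul_apply, t00, t01, l01, l11]; ring
  have htl10 : (t * l) 1 0 = ((γ 1 0 : ℤ) : ℚ) := by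
    rw [sl2Rat_mul_apply, t10, t11, l00, l10, zero_mul, zero_add, mul_div_cancel₀ _ h4]
  have htl11 : (t * l) 1 1 = (4 : ℚ) ^ k := by rw [sl2Rat_mul_apply, t10, t11, l01, l11]; ring
  have hfac : (γ : SL(2, ℚ)) = u * (t * l) := by
    refine sl2Rat_ext ?_ ?_ ?_ ?_
    · rw [sl2Rat_mul_apply, coe_rat_apply, u00, u01, htl00, htl10]
      field_simp
      linear_combination hdet
    · rw [sl2Rat_mul_apply, coe_rat_apply, u00, u01, htl01, htl11, one_mul, zero_add, div_mul_cancel₀ _ h4]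
    · rw [sl2Rat_mul_apply, coe_rat_apply, u10, u11, htl00, htl10]; ring
    · rw [sl2Rat_mul_apply, coe_rat_apply, u10, u11, htl01, htl11, hd]; push_cast; ring
  rw [hfac, hadd _ _ hDu (dyadic_pred_mul hD hDt hDl), hadd _ _ hDt hDl, chit_upper hD hadd u00 u10 u11 hb,
    chit_diag_four_pow hD hadd k t00 t01 t10 t11, chit_lower hD hadd l00 l01 l11 hc, add_zero, add_zero]

/-- **V is automatic for characters of `Λ(N)`**: if `χ̃` is additive on `Λ(N)` and kills `−1`, then `χ = χ̃|Γ₀(N)` kills every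
`γ ∈ Γ₀(N)` with `|d(γ)| = 4^k` — the hypothesis V of `CuspSpanEvenAtTwo N` and of the FOUR-SHIFT node (♠)_N. [folklore] -/
theorem chi_eq_zero_of_dyadic_of_natAbs_eq_four_pow
    (hD : ∀ g : SL(2, ℚ), D g ↔ (∀ i j, ∃ n : ℕ, ∃ m : ℤ, g i j = m / 2 ^ n) ∧ ∃ n : ℕ, ∃ m : ℤ, g 1 0 = N * m / 2 ^ n)
    (hadd : ∀ g h, D g → D h → χt (g * h) = χt g + χt h)
    (hneg : χt ((-1 : SL(2, ℤ)) : SL(2, ℚ)) = 0)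
    (γ : Gamma0 N) (h : ∃ k : ℕ, ((γ : SL(2, ℤ)) 1 1).natAbs = 4 ^ k) :
    χt ((γ : SL(2, ℤ)) : SL(2, ℚ)) = 0 := by
  obtain ⟨k, hk⟩ := h
  rcases Int.natAbs_eq_iff.mp hk with hpos | hneg'
  · push_cast at hpos
    exact chi_eq_zero_of_dyadic_of_apply_one_one_eq_four_pow hD hadd γ.2 k hpos
  · push_cast at hneg'
    have hm1 : (-1 : SL(2, ℤ)) ∈ Gamma0 N := by rw [Gamma0_mem]; simp
    have hmγ : -(γ : SL(2, ℤ)) ∈ Gamma0 N := by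
      have h2 := Gamma0_mem.mp γ.2
      rw [Gamma0_mem, Matrix.SpecialLinearGroup.coe_neg, Matrix.neg_apply, Int.cast_neg, neg_eq_zero]
      exact h2
    have hd' : (-(γ : SL(2, ℤ))) 1 1 = 4 ^ k := by
      change (-((γ : SL(2, ℤ)) : Matrix (Fin 2) (Fin 2) ℤ)) 1 1 = 4 ^ k
      rw [Matrix.neg_apply]
      exact (congrArg Neg.neg hneg').trans (neg_neg _)
    have hprod : ((γ : SL(2, ℤ)) : SL(2, ℚ)) = ((-1 : SL(2, ℤ)) : SL(2, ℚ)) * ((-(γ : SL(2, ℤ)) : SL(2, ℤ)) : SL(2, ℚ)) := by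
      rw [← map_mul, neg_one_mul, neg_neg]
    rw [hprod, hadd _ _ (dyadic_pred_coe hD hm1) (dyadic_pred_coe hD hmγ), hneg, zero_add]
    exact chi_eq_zero_of_dyadic_of_apply_one_one_eq_four_pow hD hadd hmγ k hd'

/-! ## §4. Restrictions of characters of `Λ(N)` are four-shift invariant -/

/-- **(Inv4) is automatic for characters of `Λ(N)`**: for `γ = (a, b; 4c, d)` and `γ' = (a, 4b; c, d)` in `Γ₀(N)`,
`γ' = h γ h⁻¹` with `h = diag(2, ½) ∈ Λ(N)`, so `χ̃(γ') = χ̃(γ)`. [folklore] -/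
theorem chi_fourShift_of_dyadic
    (hD : ∀ g : SL(2, ℚ), D g ↔ (∀ i j, ∃ n : ℕ, ∃ m : ℤ, g i j = m / 2 ^ n) ∧ ∃ n : ℕ, ∃ m : ℤ, g 1 0 = N * m / 2 ^ n)
    (hadd : ∀ g h, D g → D h → χt (g * h) = χt g + χt h)
    (γ γ' : Gamma0 N) (h00 : (γ' : SL(2, ℤ)) 0 0 = (γ : SL(2, ℤ)) 0 0)
    (h01 : (γ' : SL(2, ℤ)) 0 1 = 4 * (γ : SL(2, ℤ)) 0 1) (h10 : 4 * (γ' : SL(2, ℤ)) 1 0 = (γ : SL(2, ℤ)) 1 0)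
    (h11 : (γ' : SL(2, ℤ)) 1 1 = (γ : SL(2, ℤ)) 1 1) :
    χt ((γ' : SL(2, ℤ)) : SL(2, ℚ)) = χt ((γ : SL(2, ℤ)) : SL(2, ℚ)) := by
  obtain ⟨h, e00, e01, e10, e11⟩ := exists_sl2Rat_entries (2 : ℚ) 0 0 2⁻¹ (by simp)
  obtain ⟨h', f00, f01, f10, f11⟩ := exists_sl2Rat_entries (2 : ℚ)⁻¹ 0 0 2 (by simp)
  have hDh : D h :=
    dyadic_pred_of_entries hD ⟨0, 2, by rw [e00]; simp⟩ ⟨0, 0, by rw [e01]; simp⟩ ⟨0, 0, by rw [e10]; simp⟩ ⟨1, 1, by rw [e11]; simp⟩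
  have hDh' : D h' :=
    dyadic_pred_of_entries hD ⟨1, 1, by rw [f00]; simp⟩ ⟨0, 0, by rw [f01]; simp⟩ ⟨0, 0, by rw [f10]; simp⟩ ⟨0, 2, by rw [f11]; simp⟩
  have h01' : (((γ' : SL(2, ℤ)) 0 1 : ℤ) : ℚ) = 4 * (((γ : SL(2, ℤ)) 0 1 : ℤ) : ℚ) := by exact_mod_cast h01
  have h10' : 4 * (((γ' : SL(2, ℤ)) 1 0 : ℤ) : ℚ) = (((γ : SL(2, ℤ)) 1 0 : ℤ) : ℚ) := by exact_mod_cast h10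
  -- entries of `γ h'`
  have g00 : (((γ : SL(2, ℤ)) : SL(2, ℚ)) * h') 0 0 = (((γ : SL(2, ℤ)) 0 0 : ℤ) : ℚ) * 2⁻¹ := by
    rw [sl2Rat_mul_apply, coe_rat_apply, coe_rat_apply, f00, f10]; ring
  have g01 : (((γ : SL(2, ℤ)) : SL(2, ℚ)) * h') 0 1 = (((γ : SL(2, ℤ)) 0 1 : ℤ) : ℚ) * 2 := by
    rw [sl2Rat_mul_apply, coe_rat_apply, coe_rat_apply, f01, f11]; ring
  have g10 : (((γ : SL(2, ℤ)) : SL(2, ℚ)) * h') 1 0 = (((γ : SL(2, ℤ)) 1 0 : ℤ) : ℚ) * 2⁻¹ := by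
    rw [sl2Rat_mul_apply, coe_rat_apply, coe_rat_apply, f00, f10]; ring
  have g11 : (((γ : SL(2, ℤ)) : SL(2, ℚ)) * h') 1 1 = (((γ : SL(2, ℤ)) 1 1 : ℤ) : ℚ) * 2 := by
    rw [sl2Rat_mul_apply, coe_rat_apply, coe_rat_apply, f01, f11]; ring
  have hconj : ((γ' : SL(2, ℤ)) : SL(2, ℚ)) = h * (((γ : SL(2, ℤ)) : SL(2, ℚ)) * h') := by
    refine sl2Rat_ext ?_ ?_ ?_ ?_
    · rw [sl2Rat_mul_apply, coe_rat_apply, e00, e01, g00, g10, h00]; ring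
    · rw [sl2Rat_mul_apply, coe_rat_apply, e00, e01, g01, g11, h01']; ring
    · rw [sl2Rat_mul_apply, coe_rat_apply, e10, e11, g00, g10, ← h10']; ring
    · rw [sl2Rat_mul_apply, coe_rat_apply, e10, e11, g01, g11, h11]; ring
  -- `χ̃(h) + χ̃(h') = χ̃(h h') = χ̃(1) = 0`
  have hhh' : h * h' = 1 := sl2Rat_ext (by rw [sl2Rat_mul_apply, e00, e01, f00, f10]; simp)
    (by rw [sl2Rat_mul_apply, e00, e01, f01, f11]; simp) (by rw [sl2Rat_mul_apply, e10, e11, f00, f10]; simp)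
    (by rw [sl2Rat_mul_apply, e10, e11, f01, f11]; simp)
  have hsum : χt h + χt h' = 0 := by rw [← hadd _ _ hDh hDh', hhh']; exact chit_one hD hadd
  rw [hconj, hadd _ _ hDh (dyadic_pred_mul hD (dyadic_pred_coe hD γ.2) hDh'), hadd _ _ (dyadic_pred_coe hD γ.2) hDh']
  linear_combination hsum

/-- **(Inv4), first-column form**: if `χ̃` is additive on `Λ(N)` and `χ = χ̃|Γ₀(N)` kills the elements of trace `0, ±1, ±2`, then
`χ γ' = χ γ` whenever `γ'` has first column `(a, 4c)` and `γ` has first column `(a, c)` — the hypothesis shape of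
`heckeKernelSpan_of_fourShift` (`…CuspSpanFourShift`). [folklore] -/
theorem chi_fourShift_col_of_dyadic
    (hD : ∀ g : SL(2, ℚ), D g ↔ (∀ i j, ∃ n : ℕ, ∃ m : ℤ, g i j = m / 2 ^ n) ∧ ∃ n : ℕ, ∃ m : ℤ, g 1 0 = N * m / 2 ^ n)
    (hadd : ∀ g h, D g → D h → χt (g * h) = χt g + χt h)
    (hsmall : ∀ γ : Gamma0 N, ((γ : SL(2, ℤ)) 0 0 + (γ : SL(2, ℤ)) 1 1).natAbs ≤ 2 → χt ((γ : SL(2, ℤ)) : SL(2, ℚ)) = 0)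
    (γ γ' : Gamma0 N) (h00 : (γ' : SL(2, ℤ)) 0 0 = (γ : SL(2, ℤ)) 0 0) (h10 : (γ' : SL(2, ℤ)) 1 0 = 4 * (γ : SL(2, ℤ)) 1 0) :
    χt ((γ' : SL(2, ℤ)) : SL(2, ℚ)) = χt ((γ : SL(2, ℤ)) : SL(2, ℚ)) := by
  -- additivity of `χ = χ̃ ∘ ↑` on `Γ₀(N)`
  have haddχ : ∀ δ ε : Gamma0 N, (fun η : Gamma0 N ↦ χt ((η : SL(2, ℤ)) : SL(2, ℚ))) (δ * ε) =
      (fun η : Gamma0 N ↦ χt ((η : SL(2, ℤ)) : SL(2, ℚ))) δ + (fun η : Gamma0 N ↦ χt ((η : SL(2, ℤ)) : SL(2, ℚ))) ε := by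
    intro δ ε
    simp only [Subgroup.coe_mul, map_mul]
    exact hadd _ _ (dyadic_pred_coe hD δ.2) (dyadic_pred_coe hD ε.2)
  -- the partner `γ₁ = (a, 4b'; c, d')` of `γ' = (a, b'; 4c, d')`: conjugate to `γ'`, same first column as `γ`
  have hdet' := Matrix.SpecialLinearGroup.det_coe (γ' : SL(2, ℤ))
  rw [Matrix.det_fin_two, h10] at hdet'
  obtain ⟨γ₁, e00, e01, e10, e11⟩ :=
    ThetaLayerLambdaCongruenceAtTwo.exists_gamma0_entries (N := N) ((γ' : SL(2, ℤ)) 0 0) (4 * (γ' : SL(2, ℤ)) 0 1)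
      ((γ : SL(2, ℤ)) 1 0) ((γ' : SL(2, ℤ)) 1 1) (by linear_combination hdet') (dvd_entry_of_mem_Gamma0 N γ.2)
  have h1 : χt ((γ₁ : SL(2, ℤ)) : SL(2, ℚ)) = χt ((γ' : SL(2, ℤ)) : SL(2, ℚ)) :=
    chi_fourShift_of_dyadic hD hadd γ' γ₁ e00 e01 (by rw [e10, h10]) e11
  have h2 : χt ((γ₁ : SL(2, ℤ)) : SL(2, ℚ)) = χt ((γ : SL(2, ℤ)) : SL(2, ℚ)) :=
    chi_eq_of_col_eq (χ := fun η : Gamma0 N ↦ χt ((η : SL(2, ℤ)) : SL(2, ℚ))) haddχ hsmall (by rw [e00, h00]) (by rw [e10])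
  exact h1.symm.trans h2

/-- **No `T₂`-killed class extends to `Λ(N)`** (odd `N`): an additive `χ̃` on `Λ(N)` whose restriction `χ` to `Γ₀(N)` kills the
elements of trace `0, ±1, ±2` and is `T₂`-killed (explicit correspondents `colB`, `colD`) has `χ = 0` — four-shift invariance (§4) fed
to `chi_eq_zero_of_fourShift_of_heckeT_two` of `…CuspSpanFourShift`. (On the habitat: the mod-`2` plus character of a newform with
`a₂ = 0` never extends to the `2`-arithmetic group.) [cite: CremonaAlgorithms1997, §2.4 (2.4.1)–(2.4.2)] -/
theorem chi_eq_zero_of_dyadic_of_heckeT_two (hN : ¬ 2 ∣ N)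
    (hD : ∀ g : SL(2, ℚ), D g ↔ (∀ i j, ∃ n : ℕ, ∃ m : ℤ, g i j = m / 2 ^ n) ∧ ∃ n : ℕ, ∃ m : ℤ, g 1 0 = N * m / 2 ^ n)
    (hadd : ∀ g h, D g → D h → χt (g * h) = χt g + χt h)
    (hsmall : ∀ γ : Gamma0 N, ((γ : SL(2, ℤ)) 0 0 + (γ : SL(2, ℤ)) 1 1).natAbs ≤ 2 → χt ((γ : SL(2, ℤ)) : SL(2, ℚ)) = 0)
    (hT2 : ∀ γ : Gamma0 N,
      χt ((EisensteinCovector.colB Nat.prime_two γ 0 : Gamma0 N) : SL(2, ℤ)) +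
        χt ((EisensteinCovector.colB Nat.prime_two γ 1 : Gamma0 N) : SL(2, ℤ)) +
          χt ((EisensteinCovector.colD Nat.prime_two γ : Gamma0 N) : SL(2, ℤ)) = 0) :
    ∀ γ : Gamma0 N, χt ((γ : SL(2, ℤ)) : SL(2, ℚ)) = 0 := by
  have haddχ : ∀ δ ε : Gamma0 N, (fun η : Gamma0 N ↦ χt ((η : SL(2, ℤ)) : SL(2, ℚ))) (δ * ε) =
      (fun η : Gamma0 N ↦ χt ((η : SL(2, ℤ)) : SL(2, ℚ))) δ + (fun η : Gamma0 N ↦ χt ((η : SL(2, ℤ)) : SL(2, ℚ))) ε := by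
    intro δ ε
    simp only [Subgroup.coe_mul, map_mul]
    exact hadd _ _ (dyadic_pred_coe hD δ.2) (dyadic_pred_coe hD ε.2)
  exact chi_eq_zero_of_fourShift_of_heckeT_two (χ := fun η : Gamma0 N ↦ χt ((η : SL(2, ℤ)) : SL(2, ℚ))) hN haddχ hsmall hT2
    fun γ γ' h00 h10 ↦ chi_fourShift_col_of_dyadic hD hadd hsmall γ γ' h00 h10

end Dyadic

end Summit.BirchSwinnertonDyer.BirchSwinnertonDyer.Theorems.SignedMuAtTwo

end
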